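import Mathlib
import HarnessLib
import Literature.Analysis.FluidPDE.FirstIntegralTransportDefect

/-!
# Route `PoloidalWindowDoor`, item `LrcModEntire` (stmt-NavierStokesRegularity-20428), cell (Q4-sonic), slot `stub_Q4sonicLineNeg` —
# HUYGENS IN TIME: the web's normal speed at `τ = 0` SPLITS, `V(s,z) = α(s) + β(z)` (class-free calculus)

Cell ns-regularity-ideate, helper seat ns-k2-port-2 g8 under the LEAD of item 20428 (ns-poloidal-K2-p3 g16); `--supports stmt-NavierStokesRegularity-20428 --as helper`.
Memo `Cruxes/LrcModEntire/HOT-SHEET-port2g8.md` §3(b),(3g) in kernel form.  The Huygens identity of the web package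
(`…ParallelWebsIdentity.huygens_identity`: `κ·G_z² = (R″ − μκ)·(1 + G_s²)`, coefficients functions of the HEIGHT only) does not use the pin `G(s,0) = 0`, so it
holds on every nearby time slice `τ` for the time-dependent web function `G(τ,s,z)`.  Over a straight sonic branch the webs are parallel AT `τ = 0`:
`G(0,s,z) = d(z)` with `d′ ≠ 0` (the characteristic sheet, `d′² = −μ > 0` — exactly the slot `μ(−1,0) < 0`).  Differentiating the family of identities in `τ` at
`τ = 0` (where `G_s = 0`, `G_z = d′`) gives `2κd′·∂_τ∂_zG = ∂_τ(R″ − μκ) − ∂_τκ·d′²`, a function of `z` alone: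

* `webSpeed_zderiv_eq` — the explicit value of `∂_τ∂_zG(0,s,z)` in terms of the `τ`-derivatives of the coefficients at `(0,z)`;
* ★ `webSpeed_zderiv_indep` — **`∂_τ∂_zG(0,s,z) = ∂_τ∂_zG(0,s′,z)`** for all `s, s′`: the height-derivative of the web speed `V = ∂_τG(0,·,·)` does not depend on `s`;
  `fderiv_dz_dtau_swap` (Schwarz) and ★ `webSpeed_split` — on a height interval, **`V(s,z) − V(s′,z)` does not depend on `z`**, i.e. `V(s,z) = α(s) + β(z)`
  (the webs stay parallel to first order in `τ` iff `α′ ≡ 0`, which nothing in the tree forces — memo §3(c),(3g)).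

Currency: `G : ℝ × ℝ × ℝ → ℝ` in the variables `q = (τ, s, z)`, `C²` on an open set `O`; partial derivatives as `fderiv ℝ G q` applied to `(1,0,0)`, `(0,1,0)`,
`(0,0,1)`; the conclusion is stated for `D(q ↦ ∂_zG(q))(0,s,z)[(1,0,0)]`.

WHAT THIS IS NOT: not a claim about Navier–Stokes regularity — calculus for the hypothetical time-dependent web of the research slot `stub_Q4sonicLineNeg`
(registry twist_split v11); no stub is closed here; items 20428 / 19708 / 27893 OPEN.
-/

noncomputable section

set_option linter.dupNamespace false
set_option linter.style.longLine false

namespace Summit.NavierStokesRegularity.NavierStokesRegularity.Theorems.PoloidalWindowDoorLrcModEntireQ4SonicHotSheetTimeSplit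

open Set Function Filter Topology Metric
open scoped ContDiff
open Literature.Analysis.FluidPDE

/-- The `τ`-coordinate line through `(·, s, z)` (the three coordinate directions of `ℝ × ℝ × ℝ` are `τ`, `s`, `z`). -/
theorem hasDerivAt_tauLine (s z τ : ℝ) : HasDerivAt (fun a : ℝ => ((a, s, z) : ℝ × ℝ × ℝ)) ((1 : ℝ), (0 : ℝ), (0 : ℝ)) τ := by
  have h : HasDerivAt (fun a : ℝ => ((a, s, z) : ℝ × ℝ × ℝ)) ((1 : ℝ), (0 : ℝ), (0 : ℝ)) τ :=
    (hasDerivAt_id τ).prodMk ((hasDerivAt_const τ s).prodMk (hasDerivAt_const τ z))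
  exact h

/-- The `s`-coordinate line through `(τ, ·, z)`. -/
theorem hasDerivAt_sLine (τ z s : ℝ) : HasDerivAt (fun a : ℝ => ((τ, a, z) : ℝ × ℝ × ℝ)) ((0 : ℝ), (1 : ℝ), (0 : ℝ)) s :=
  (hasDerivAt_const s τ).prodMk ((hasDerivAt_id s).prodMk (hasDerivAt_const s z))

/-- The `z`-coordinate line through `(τ, s, ·)`. -/
theorem hasDerivAt_zLine (τ s z : ℝ) : HasDerivAt (fun a : ℝ => ((τ, s, a) : ℝ × ℝ × ℝ)) ((0 : ℝ), (0 : ℝ), (1 : ℝ)) z :=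
  (hasDerivAt_const z τ).prodMk ((hasDerivAt_const z s).prodMk (hasDerivAt_id z))

variable {G : ℝ × ℝ × ℝ → ℝ} {O : Set (ℝ × ℝ × ℝ)} {I : Set ℝ} {d : ℝ → ℝ} {κ R2 μ : ℝ → ℝ → ℝ}

/-- At `τ = 0` the `s`-derivative of the web function vanishes: `G(0,s,z) = d(z)` for all `s`. -/
theorem fderiv_s_eq_zero_of_pin (hO : IsOpen O) (hG : ContDiffOn ℝ 2 G O) (hpin : ∀ s, ∀ z ∈ I, G (0, s, z) = d z)
    {s z : ℝ} (hz : z ∈ I) (hq : ((0 : ℝ), s, z) ∈ O) :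
    fderiv ℝ G ((0 : ℝ), s, z) ((0 : ℝ), (1 : ℝ), (0 : ℝ)) = 0 := by
  have hGd : DifferentiableAt ℝ G ((0 : ℝ), s, z) := (hG.contDiffAt (hO.mem_nhds hq)).differentiableAt (by norm_num)
  have h1 : HasDerivAt (fun a : ℝ => G ((0 : ℝ), a, z)) (fderiv ℝ G ((0 : ℝ), s, z) ((0 : ℝ), (1 : ℝ), (0 : ℝ))) s :=
    hGd.hasFDerivAt.comp_hasDerivAt s (hasDerivAt_sLine 0 z s)
  have h2 : HasDerivAt (fun a : ℝ => G ((0 : ℝ), a, z)) 0 s := by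
    have h : (fun a : ℝ => G ((0 : ℝ), a, z)) = fun _ => d z := funext fun a => hpin a z hz
    rw [h]; exact hasDerivAt_const s (d z)
  exact h1.unique h2

/-- At `τ = 0` the `z`-derivative of the web function is `d′(z)`: `G(0,s,·) = d` on the open height window `I`. -/
theorem fderiv_z_eq_deriv_of_pin (hO : IsOpen O) (hG : ContDiffOn ℝ 2 G O) (hI : IsOpen I) (hpin : ∀ s, ∀ z ∈ I, G (0, s, z) = d z)
    (hd : ∀ z ∈ I, DifferentiableAt ℝ d z) {s z : ℝ} (hz : z ∈ I) (hq : ((0 : ℝ), s, z) ∈ O) :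
    fderiv ℝ G ((0 : ℝ), s, z) ((0 : ℝ), (0 : ℝ), (1 : ℝ)) = deriv d z := by
  have hGd : DifferentiableAt ℝ G ((0 : ℝ), s, z) := (hG.contDiffAt (hO.mem_nhds hq)).differentiableAt (by norm_num)
  have h1 : HasDerivAt (fun a : ℝ => G ((0 : ℝ), s, a)) (fderiv ℝ G ((0 : ℝ), s, z) ((0 : ℝ), (0 : ℝ), (1 : ℝ))) z :=
    hGd.hasFDerivAt.comp_hasDerivAt z (hasDerivAt_zLine 0 s z)
  have h2 : HasDerivAt (fun a : ℝ => G ((0 : ℝ), s, a)) (deriv d z) z := by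
    have h : (fun a : ℝ => G ((0 : ℝ), s, a)) =ᶠ[𝓝 z] d := by
      filter_upwards [hI.mem_nhds hz] with a ha using hpin s a ha
    exact (hd z hz).hasDerivAt.congr_of_eventuallyEq h
  exact h1.unique h2

/-- **The value of `∂_τ∂_zG(0,s,z)`** from the family of Huygens identities `κ(τ,z)·G_z² = (R″(τ,z) − μ(τ,z)κ(τ,z))·(1 + G_s²)` on `O`, the pin
`G(0,s,·) = d` on `I`, `d′(z) ≠ 0`, `κ(0,z) ≠ 0`:
`2κ(0,z)d′(z)·D(∂_zG)(0,s,z)[(1,0,0)] = ∂_τ(R″ − μκ)(0,z) − ∂_τκ(0,z)·d′(z)²`. -/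
theorem webSpeed_zderiv_eq (hO : IsOpen O) (hG : ContDiffOn ℝ 2 G O) (hI : IsOpen I) (hpin : ∀ s, ∀ z ∈ I, G (0, s, z) = d z)
    (hd : ∀ z ∈ I, DifferentiableAt ℝ d z)
    (hH : ∀ q ∈ O, κ q.1 q.2.2 * (fderiv ℝ G q ((0 : ℝ), (0 : ℝ), (1 : ℝ))) ^ 2 =
      (R2 q.1 q.2.2 - μ q.1 q.2.2 * κ q.1 q.2.2) * (1 + (fderiv ℝ G q ((0 : ℝ), (1 : ℝ), (0 : ℝ))) ^ 2))
    {s z : ℝ} (hz : z ∈ I) (hq : ((0 : ℝ), s, z) ∈ O)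
    {κ' c' : ℝ} (hκ : HasDerivAt (fun τ => κ τ z) κ' 0) (hc : HasDerivAt (fun τ => R2 τ z - μ τ z * κ τ z) c' 0) :
    2 * κ 0 z * deriv d z * fderiv ℝ (fun q => fderiv ℝ G q ((0 : ℝ), (0 : ℝ), (1 : ℝ))) ((0 : ℝ), s, z) ((1 : ℝ), (0 : ℝ), (0 : ℝ)) =
      c' - κ' * deriv d z ^ 2 := by
  -- regularity at the base point
  have hGq : ContDiffAt ℝ 2 G ((0 : ℝ), s, z) := hG.contDiffAt (hO.mem_nhds hq)
  have hDGd : DifferentiableAt ℝ (fderiv ℝ G) ((0 : ℝ), s, z) := (hGq.fderiv_right (m := 1) le_rfl).differentiableAt (by simp)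
  set ez : ℝ × ℝ × ℝ := ((0 : ℝ), (0 : ℝ), (1 : ℝ)) with hez
  set es : ℝ × ℝ × ℝ := ((0 : ℝ), (1 : ℝ), (0 : ℝ)) with hes
  set eτ : ℝ × ℝ × ℝ := ((1 : ℝ), (0 : ℝ), (0 : ℝ)) with heτ
  -- the two partial derivatives along the `τ`-line through `(0,s,z)`
  set φ : ℝ → ℝ := fun a => fderiv ℝ G (a, s, z) ez with hφ
  set ψ : ℝ → ℝ := fun a => fderiv ℝ G (a, s, z) es with hψ
  have hφd : HasDerivAt φ (fderiv ℝ (fun q => fderiv ℝ G q ez) ((0 : ℝ), s, z) eτ) 0 := by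
    have h1 : DifferentiableAt ℝ (fun q => fderiv ℝ G q ez) ((0 : ℝ), s, z) := hDGd.clm_apply (differentiableAt_const _)
    exact h1.hasFDerivAt.comp_hasDerivAt (0 : ℝ) (hasDerivAt_tauLine s z 0)
  have hψd : HasDerivAt ψ (fderiv ℝ (fun q => fderiv ℝ G q es) ((0 : ℝ), s, z) eτ) 0 := by
    have h1 : DifferentiableAt ℝ (fun q => fderiv ℝ G q es) ((0 : ℝ), s, z) := hDGd.clm_apply (differentiableAt_const _)
    exact h1.hasFDerivAt.comp_hasDerivAt (0 : ℝ) (hasDerivAt_tauLine s z 0)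
  -- values at `τ = 0`
  have hφ0 : φ 0 = deriv d z := fderiv_z_eq_deriv_of_pin hO hG hI hpin hd hz hq
  have hψ0 : ψ 0 = 0 := fderiv_s_eq_zero_of_pin hO hG hpin hz hq
  -- the identity along the `τ`-line, near `τ = 0`
  have hnear : ∀ᶠ a : ℝ in 𝓝 0, ((a, s, z) : ℝ × ℝ × ℝ) ∈ O :=
    (hasDerivAt_tauLine s z 0).continuousAt.preimage_mem_nhds (by simpa using hO.mem_nhds hq)
  have hid : (fun a : ℝ => κ a z * φ a ^ 2) =ᶠ[𝓝 0] fun a => (R2 a z - μ a z * κ a z) * (1 + ψ a ^ 2) := by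
    filter_upwards [hnear] with a ha using hH (a, s, z) ha
  -- differentiate both sides at `τ = 0`
  have hL := hκ.fun_mul (hφd.fun_pow 2)
  have hR := hc.fun_mul ((hψd.fun_pow 2).const_add 1)
  have heq := hL.unique (hR.congr_of_eventuallyEq hid)
  rw [hφ0, hψ0] at heq
  norm_num at heq
  linear_combination heq

/-- ★ **HUYGENS IN TIME — the height-derivative of the web speed does not depend on `s`:** under the hypotheses of `webSpeed_zderiv_eq` with `κ(0,z) ≠ 0`,
`d′(z) ≠ 0` and the coefficients differentiable in `τ` at `(0,z)`, `D(∂_zG)(0,s,z)[(1,0,0)] = D(∂_zG)(0,s′,z)[(1,0,0)]` for all `s, s′` with `(0,s,z), (0,s′,z) ∈ O`.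
Hence (Schwarz) the web speed `V = ∂_τG(0,·,·)` has `∂_s∂_zV = 0`: `V(s,z) = α(s) + β(z)` on rectangles. -/
theorem webSpeed_zderiv_indep (hO : IsOpen O) (hG : ContDiffOn ℝ 2 G O) (hI : IsOpen I) (hpin : ∀ s, ∀ z ∈ I, G (0, s, z) = d z)
    (hd : ∀ z ∈ I, DifferentiableAt ℝ d z)
    (hH : ∀ q ∈ O, κ q.1 q.2.2 * (fderiv ℝ G q ((0 : ℝ), (0 : ℝ), (1 : ℝ))) ^ 2 =
      (R2 q.1 q.2.2 - μ q.1 q.2.2 * κ q.1 q.2.2) * (1 + (fderiv ℝ G q ((0 : ℝ), (1 : ℝ), (0 : ℝ))) ^ 2))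
    {z : ℝ} (hz : z ∈ I) (hκ0 : κ 0 z ≠ 0) (hd0 : deriv d z ≠ 0)
    (hκ : DifferentiableAt ℝ (fun τ => κ τ z) 0) (hR2 : DifferentiableAt ℝ (fun τ => R2 τ z) 0) (hμ : DifferentiableAt ℝ (fun τ => μ τ z) 0)
    {s s' : ℝ} (hq : ((0 : ℝ), s, z) ∈ O) (hq' : ((0 : ℝ), s', z) ∈ O) :
    fderiv ℝ (fun q => fderiv ℝ G q ((0 : ℝ), (0 : ℝ), (1 : ℝ))) ((0 : ℝ), s, z) ((1 : ℝ), (0 : ℝ), (0 : ℝ)) =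
      fderiv ℝ (fun q => fderiv ℝ G q ((0 : ℝ), (0 : ℝ), (1 : ℝ))) ((0 : ℝ), s', z) ((1 : ℝ), (0 : ℝ), (0 : ℝ)) := by
  have hc : HasDerivAt (fun τ => R2 τ z - μ τ z * κ τ z) (deriv (fun τ => R2 τ z - μ τ z * κ τ z) 0) 0 :=
    (hR2.sub (hμ.mul hκ)).hasDerivAt
  have h1 := webSpeed_zderiv_eq hO hG hI hpin hd hH hz hq hκ.hasDerivAt hc
  have h2 := webSpeed_zderiv_eq hO hG hI hpin hd hH hz hq' hκ.hasDerivAt hc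
  have hne : 2 * κ 0 z * deriv d z ≠ 0 := mul_ne_zero (mul_ne_zero two_ne_zero hκ0) hd0
  exact mul_left_cancel₀ hne (h1.trans h2.symm)

/-- Schwarz for the web function: `D(∂_zG)(q)[(1,0,0)] = D(∂_τG)(q)[(0,0,1)]` at a `C²` point. -/
theorem fderiv_dz_dtau_swap {q : ℝ × ℝ × ℝ} (hGq : ContDiffAt ℝ 2 G q) :
    fderiv ℝ (fun q => fderiv ℝ G q ((0 : ℝ), (0 : ℝ), (1 : ℝ))) q ((1 : ℝ), (0 : ℝ), (0 : ℝ)) =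
      fderiv ℝ (fun q => fderiv ℝ G q ((1 : ℝ), (0 : ℝ), (0 : ℝ))) q ((0 : ℝ), (0 : ℝ), (1 : ℝ)) := by
  have hDGd : DifferentiableAt ℝ (fderiv ℝ G) q := (hGq.fderiv_right (m := 1) le_rfl).differentiableAt (by simp)
  rw [fderiv_apply_const_apply_eq_fderiv_fderiv hDGd, fderiv_apply_const_apply_eq_fderiv_fderiv hDGd]
  exact hGq.isSymmSndFDerivAt (by simp only [minSmoothness_of_isRCLikeNormedField]; norm_num) _ _

/-- ★ **THE SPLIT `V(s,z) = α(s) + β(z)` of the web speed** `V(s,z) := ∂_τG(0,s,z)` on a height interval `I = (z₁,z₂)`: for `s, s′` whose base lines lie in `O`,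
`V(s,z) − V(s′,z)` does not depend on `z ∈ I`. -/
theorem webSpeed_split (hO : IsOpen O) (hG : ContDiffOn ℝ 2 G O) {z₁ z₂ : ℝ} (hI : I = Ioo z₁ z₂) (hpin : ∀ s, ∀ z ∈ I, G (0, s, z) = d z)
    (hd : ∀ z ∈ I, DifferentiableAt ℝ d z)
    (hH : ∀ q ∈ O, κ q.1 q.2.2 * (fderiv ℝ G q ((0 : ℝ), (0 : ℝ), (1 : ℝ))) ^ 2 =
      (R2 q.1 q.2.2 - μ q.1 q.2.2 * κ q.1 q.2.2) * (1 + (fderiv ℝ G q ((0 : ℝ), (1 : ℝ), (0 : ℝ))) ^ 2))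
    (hκ0 : ∀ z ∈ I, κ 0 z ≠ 0) (hd0 : ∀ z ∈ I, deriv d z ≠ 0)
    (hκ : ∀ z ∈ I, DifferentiableAt ℝ (fun τ => κ τ z) 0) (hR2 : ∀ z ∈ I, DifferentiableAt ℝ (fun τ => R2 τ z) 0)
    (hμ : ∀ z ∈ I, DifferentiableAt ℝ (fun τ => μ τ z) 0)
    {s s' : ℝ} (hs : ∀ z ∈ I, ((0 : ℝ), s, z) ∈ O) (hs' : ∀ z ∈ I, ((0 : ℝ), s', z) ∈ O) {z z₀ : ℝ} (hz : z ∈ I) (hz₀ : z₀ ∈ I) :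
    fderiv ℝ G ((0 : ℝ), s, z) ((1 : ℝ), (0 : ℝ), (0 : ℝ)) - fderiv ℝ G ((0 : ℝ), s', z) ((1 : ℝ), (0 : ℝ), (0 : ℝ)) =
      fderiv ℝ G ((0 : ℝ), s, z₀) ((1 : ℝ), (0 : ℝ), (0 : ℝ)) - fderiv ℝ G ((0 : ℝ), s', z₀) ((1 : ℝ), (0 : ℝ), (0 : ℝ)) := by
  subst hI
  set eτ : ℝ × ℝ × ℝ := ((1 : ℝ), (0 : ℝ), (0 : ℝ)) with heτ
  set ez : ℝ × ℝ × ℝ := ((0 : ℝ), (0 : ℝ), (1 : ℝ)) with hez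
  -- the difference `D(w) = V(s,w) − V(s′,w)` has zero derivative on the interval
  set D : ℝ → ℝ := fun w => fderiv ℝ G ((0 : ℝ), s, w) eτ - fderiv ℝ G ((0 : ℝ), s', w) eτ with hD
  have hderiv : ∀ w ∈ Ioo z₁ z₂, HasDerivAt D 0 w := by
    intro w hw
    have hq : ContDiffAt ℝ 2 G ((0 : ℝ), s, w) := hG.contDiffAt (hO.mem_nhds (hs w hw))
    have hq' : ContDiffAt ℝ 2 G ((0 : ℝ), s', w) := hG.contDiffAt (hO.mem_nhds (hs' w hw))
    have hD1 : DifferentiableAt ℝ (fderiv ℝ G) ((0 : ℝ), s, w) := (hq.fderiv_right (m := 1) le_rfl).differentiableAt (by simp)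
    have hD1' : DifferentiableAt ℝ (fderiv ℝ G) ((0 : ℝ), s', w) := (hq'.fderiv_right (m := 1) le_rfl).differentiableAt (by simp)
    have h1 : HasDerivAt (fun w : ℝ => fderiv ℝ G ((0 : ℝ), s, w) eτ) (fderiv ℝ (fun q => fderiv ℝ G q eτ) ((0 : ℝ), s, w) ez) w := by
      have h := (hD1.clm_apply (differentiableAt_const eτ)).hasFDerivAt.comp_hasDerivAt w (hasDerivAt_zLine 0 s w)
      simpa only [Function.comp_def] using h
    have h1' : HasDerivAt (fun w : ℝ => fderiv ℝ G ((0 : ℝ), s', w) eτ) (fderiv ℝ (fun q => fderiv ℝ G q eτ) ((0 : ℝ), s', w) ez) w := by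
      have h := (hD1'.clm_apply (differentiableAt_const eτ)).hasFDerivAt.comp_hasDerivAt w (hasDerivAt_zLine 0 s' w)
      simpa only [Function.comp_def] using h
    have hsw := webSpeed_zderiv_indep hO hG isOpen_Ioo hpin hd hH hw (hκ0 w hw) (hd0 w hw) (hκ w hw) (hR2 w hw) (hμ w hw) (hs w hw) (hs' w hw)
    rw [fderiv_dz_dtau_swap hq, fderiv_dz_dtau_swap hq'] at hsw
    have h := h1.sub h1'
    rw [hsw, sub_self] at h
    exact h
  have hconst := isOpen_Ioo.is_const_of_deriv_eq_zero isPreconnected_Ioo (fun w hw => (hderiv w hw).differentiableAt.differentiableWithinAt)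
    (fun w hw => (hderiv w hw).deriv) hz hz₀
  exact hconst

end Summit.NavierStokesRegularity.NavierStokesRegularity.Theorems.PoloidalWindowDoorLrcModEntireQ4SonicHotSheetTimeSplit

end
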